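import Literature.NumberTheory.EllipticCurves.ZpExtensionEisensteinDVRSettingLevelsTame
import Literature.NumberTheory.EllipticCurves.ZpExtensionEisensteinH2TowerProofs
import Literature.NumberTheory.EllipticCurves.ZpExtensionEisensteinH3OrdinaryProofs
import Literature.NumberTheory.EllipticCurves.ZpExtensionEisensteinDVRSettingH4UnramifiedProofs
import Literature.NumberTheory.EllipticCurves.ZpExtensionEisensteinDVRSettingH5bReductionProofs
import HarnessLib

/-!
# `SatisfiesH` for the levels-tame Eisenstein setting of `E_K` with the CANONICAL conjugation datum: four of the eight
# named inputs of `eisensteinDVRSettingLevelsTame_satisfiesH_of` discharged by name (proofs file)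

Topic `NumberTheory/EllipticCurves` (D1 road of cell `pub/bsd-print-x9`, STUB A `stub_howardInputs` of the shared μ-crux
«`(hy : St.SatisfiesH)`»; companion of `ZpExtensionEisensteinDVRSettingLevelsTame` (p656416)).  THEOREMS ONLY; no definition,
no named fact, no instance, no notation, no `sorry`.

For `St := W.eisensteinDVRSettingLevelsTame κ hm π S hpS hbad L hL hLS jbar cd D` with the canonical conjugation datum
`cd := ConjugationDatum.ofLifts σ hσ₁ hσ τ hτl hτ₂` (`σ` the non-trivial involution of the imaginary quadratic `K`, `τ` an
involutive lift of `σ` to `K̄` which IS the transport of a complex conjugation `c₀ ∈ Γ_ℚ`, as produced by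
`exists_conjugationDatum_ofLifts_τ_eq_absGaloisTransport`, p655735) and a `σ`-STABLE finite set `S` of places (above `p` and
the bad places), Howard's standing hypotheses H.0–H.5 (`DVRSetting.SatisfiesH`) hold GIVEN ONLY:
* the frame (`p ≠ 2`, `K` imaginary quadratic, `E_K[p]` irreducible with Schur's lemma, `κ` anticyclotomic up to its kernel,
  ONE homothety `z ≡ a` on `E_K[p]` with `p ∤ a − 1`);
* the two `D`-dependent reduction / sign identities `he_red`, `h5c` of the H.4 data `D` (both delivered with `D` by
  `exists_eisensteinDualityData`, p656419);
* the tree's Poitou–Tate named fact `poitouTate_selmerStructure_duality K` (binder `hPT`, Milne I Thm. 2.6 / 4.10(b));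
* the genuinely local-arithmetic clauses of H.4 and H.5(b) AT THE FINITELY MANY PLACES `v ∈ S` (`hfin4`, `hfin5b`).
The four inputs `h2` (`eisensteinTower_h2Tower`, p655472), `h3` (`eisensteinDVRSetting_h3_of_isImaginaryQuadratic`, p656748),
`h4` off `S` (`eisensteinDVRSetting_h4_of_ofLifts`, p656723) and `h5b` off `S` (`eisensteinDVRSetting_h5b_of`, p653453) of
`eisensteinDVRSettingLevelsTame_satisfiesH_of` are discharged BY NAME:
* **`WeierstrassCurve.eisensteinDVRSettingLevelsTame_satisfiesH_of_ofLifts`**.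
Every statement carries the CONSUMER PREAMBLE of `ZpExtensionEisensteinDVRSetting`.  HONEST FRAMING: conditional on the named
fact `poitouTate_selmerStructure_duality K`; the clauses at `v ∈ S` are hypotheses.  BSD is not proved by any of this.

References: [Howard2004HeegnerKolyvagin] §1.3 H.0–H.5 and §1.6 (arXiv:1202.6340 p. 7 L55 – p. 8 L1, p. 11 L13–38), Lemma 2.6.2,
Def. 3.1.2; [MilneADT2006] I Thm. 2.6, Thm. 4.10; [Gross1984] §1.
-/

set_option autoImplicit false

noncomputable section

open Function NumberField IsDedekindDomain Field
open scoped NumberField ContRepresentation TensorProduct Classical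

namespace WeierstrassCurve

open Literature.NumberTheory.EllipticCurves Literature.NumberTheory.GaloisRepresentations
open Literature.NumberTheory.GaloisRepresentations.DiscreteGaloisModule
open Literature.NumberTheory.GaloisCohomology Literature.NumberTheory.GaloisCohomology.Howard2004
open Literature.NumberTheory.EllipticCurves.ZpExtension (EisensteinLevel)

variable {K : Type} [Field K] [NumberField K] (W : WeierstrassCurve ℚ) [W.IsElliptic] {p : ℕ} [hp : Fact p.Prime]
  (κ : ZpExtension K p) {m : ℕ} (hm : 1 ≤ m) (π : ∀ v : HeightOneSpectrum (𝓞 K), TamePin v)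
  (S : Finset (HeightOneSpectrum (𝓞 K)))
  (hpS : ∀ v : HeightOneSpectrum (𝓞 K), ((p : ℕ) : 𝓞 K) ∈ v.asIdeal → v ∈ S)
  (hbad : ∀ v : HeightOneSpectrum (𝓞 K), v ∉ S → ((p : ℕ) : 𝓞 K) ∉ v.asIdeal → (W.baseChange K).HasGoodReductionAt v)
  (L : Set (HeightOneSpectrum (𝓞 K)))
  (hL : letI := IwasawaAlgebra.isLocalRing_quotient_X_pow_add_C p hm
    L ⊆ (W.eisensteinTower κ hm).degreeTwoPrimes p)
  (hLS : ∀ v ∈ L, v ∉ S)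
  (jbar : AlgebraicClosure K →+* ℂ)
  (σ : K ≃ₐ[ℚ] K) (hσ₁ : σ ≠ 1) (hσ : σ * σ = 1) (τ : AlgebraicClosure K ≃+* AlgebraicClosure K)
  (hτl : IsLiftOfAut σ τ) (hτ₂ : Function.Involutive τ)
  (D : letI := IwasawaAlgebra.isLocalRing_quotient_X_pow_add_C p hm
    ∀ k, DualityDatum p (ConjugationDatum.ofLifts σ hσ₁ hσ τ hτl hτ₂) ((W.eisensteinTower κ hm).ρ k)
      (IwasawaAlgebra.EisensteinCoeff p m (k + 1)))

set_option synthInstance.maxHeartbeats 80000 in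
/-- **`SatisfiesH` for the levels-tame Eisenstein setting of `E_K` with the canonical conjugation datum
`ConjugationDatum.ofLifts σ … τ …`, `τ` the transport of a complex conjugation, `S` `σ`-stable**: Howard's H.0–H.5 hold given
the frame hypotheses (`p ≠ 2`; `K` imaginary quadratic; `E_K[p]` irreducible + Schur; `κ` with the kernel of an anticyclotomic
`κ₀`; a homothety `z ≡ a` on `E_K[p]`, `p ∤ a − 1`), the `D`-identities `he_red` / `h5c`, the Poitou–Tate named fact
`poitouTate_selmerStructure_duality K`, and the clauses of H.4 / H.5(b) at the places `v ∈ S` — the inputs `h2`, `h3`, and the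
off-`S` parts of `h4`, `h5b` of `eisensteinDVRSettingLevelsTame_satisfiesH_of` being the tree's `eisensteinTower_h2Tower`,
`eisensteinDVRSetting_h3_of_isImaginaryQuadratic`, `eisensteinDVRSetting_h4_of_ofLifts`, `eisensteinDVRSetting_h5b_of`.
[cite: Howard2004HeegnerKolyvagin, §1.3 H.0–H.5 and §1.6 (arXiv p. 7 L55 – p. 8 L1, p. 11 L13–38), Lemma 2.6.2, Def. 3.1.2]
[cite: MilneADT2006, Ch. I, Thm. 2.6 and Thm. 4.10(b)] [cite: Gross1984, §1] -/
theorem eisensteinDVRSettingLevelsTame_satisfiesH_of_ofLifts (hp2 : p ≠ 2) (hK : IsImaginaryQuadratic K)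
    (hirr : (W.baseChange K).HasIrreducibleModPGaloisRep p)
    (hschur : ∀ φ : geomTorsion (W.baseChange K) (p : ℤ) →+ geomTorsion (W.baseChange K) (p : ℤ),
      (∀ (g : absoluteGaloisGroup K) (P : geomTorsion (W.baseChange K) (p : ℤ)), φ (g • P) = g • φ P) →
        ∃ c : ℤ, ∀ P : geomTorsion (W.baseChange K) (p : ℤ), φ P = c • P)
    (κ₀ : ZpExtension K p) (hker : κ.kerSubgroup = κ₀.kerSubgroup) (hanti : κ₀.IsAnticyclotomic)
    {z : absoluteGaloisGroup K} {a : ℤ}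
    (hz : ∀ P : geomTorsion (W.baseChange K) (p : ℤ), z • P = a • P) (ha : ¬ (p : ℤ) ∣ a - 1)
    {c₀ : absoluteGaloisGroup ℚ} (hc₀ : IsComplexConjugation (Rat.castHom ℝ) c₀)
    (hτ : ∀ x, (ConjugationDatum.ofLifts σ hσ₁ hσ τ hτl hτ₂).τ x = absGaloisTransport (K := ℚ) (L := K) c₀ x)
    (hPT : poitouTate_selmerStructure_duality K)
    (hSσ : ∀ v : HeightOneSpectrum (𝓞 K), σ • v ∈ S → v ∈ S)
    (he_red : letI := IwasawaAlgebra.isLocalRing_quotient_X_pow_add_C p hm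
      ∀ k (x y : EisensteinLevel p m (fun j ↦ geomTorsion (W.baseChange K) ((p : ℤ) ^ j)) (k + 1 + 1)),
        IwasawaAlgebra.EisensteinCoeff.reduce p m (Nat.le_succ (k + 1)) ((D (k + 1)).e x y) =
          (D k).e ((W.eisensteinTower κ hm).red k x) ((W.eisensteinTower κ hm).red k y))
    (h5c :
    letI := IwasawaAlgebra.isDomain_quotient_X_pow_add_C p hm
    letI := IwasawaAlgebra.isDiscreteValuationRing_quotient_X_pow_add_C p hm
    haveI := IwasawaAlgebra.EisensteinCoeff.isLocalRing_succ p hm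
    letI := IwasawaAlgebra.EisensteinCoeff.algebraOfSpecSucc p m
    haveI := W.isScalarTower_algebraOfSpecSucc (K := K) (p := p) (m := m)
    letI := W.residueModuleSucc (K := K) (p := p) hm
      ∀ k, H5c (D k) ((W.eisensteinDVRSettingLevelsTame κ hm π S hpS hbad L hL hLS jbar
        (ConjugationDatum.ofLifts σ hσ₁ hσ τ hτl hτ₂) D).πbar k)
        (W.residualTauGeomTorsion (p := p) (ConjugationDatum.ofLifts σ hσ₁ hσ τ hτl hτ₂) hm (k := k + 1) k.succ_pos))
    (hfin4 : letI := IwasawaAlgebra.isLocalRing_quotient_X_pow_add_C p hm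
      ∀ k, ∀ v ∈ S, (D k).IsSelfOrthogonalAt (W.eisensteinTowerTriple κ hm S hpS hbad L hL hLS k).cond v)
    (hfin5b :
    letI := IwasawaAlgebra.isDomain_quotient_X_pow_add_C p hm
    letI := IwasawaAlgebra.isDiscreteValuationRing_quotient_X_pow_add_C p hm
    haveI := IwasawaAlgebra.EisensteinCoeff.isLocalRing_succ p hm
    letI := IwasawaAlgebra.EisensteinCoeff.algebraOfSpecSucc p m
    haveI := W.isScalarTower_algebraOfSpecSucc (K := K) (p := p) (m := m)
    letI := W.residueModuleSucc (K := K) (p := p) hm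
      ∀ k, ∀ v ∈ S,
        (((W.isQuotientBy_eisensteinDVRSetting_πbar κ hm S hpS hbad L hL hLS jbar
            (ConjugationDatum.ofLifts σ hσ₁ hσ τ hτl hτ₂) D (W.eisensteinLevelsTameFs κ hm π S hpS hbad L hL hLS)
            k).propagateStructure (W.eisensteinTowerTriple κ hm S hpS hbad L hL hLS k).cond) (Sum.inr (σ • v))).map
            (((W.residualTauGeomTorsion (p := p) (ConjugationDatum.ofLifts σ hσ₁ hσ τ hτl hτ₂) hm (k := k + 1)
                k.succ_pos).thetaH1 (Sum.inr v)).comp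
              ((ConjugationDatum.ofLifts σ hσ₁ hσ τ hτl hτ₂).transportH1 ((W.baseChange K).torsionGaloisModule (p : ℤ)) v)) =
          ((W.isQuotientBy_eisensteinDVRSetting_πbar κ hm S hpS hbad L hL hLS jbar
            (ConjugationDatum.ofLifts σ hσ₁ hσ τ hτl hτ₂) D (W.eisensteinLevelsTameFs κ hm π S hpS hbad L hL hLS)
            k).propagateStructure (W.eisensteinTowerTriple κ hm S hpS hbad L hL hLS k).cond) (Sum.inr v)) :
    letI := IwasawaAlgebra.isDomain_quotient_X_pow_add_C p hm
    letI := IwasawaAlgebra.isDiscreteValuationRing_quotient_X_pow_add_C p hm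
    haveI := IwasawaAlgebra.EisensteinCoeff.isLocalRing_succ p hm
    letI := IwasawaAlgebra.EisensteinCoeff.algebraOfSpecSucc p m
    haveI := W.isScalarTower_algebraOfSpecSucc (K := K) (p := p) (m := m)
    letI := W.residueModuleSucc (K := K) (p := p) hm
    (W.eisensteinDVRSettingLevelsTame κ hm π S hpS hbad L hL hLS jbar
      (ConjugationDatum.ofLifts σ hσ₁ hσ τ hτl hτ₂) D).SatisfiesH := by
  letI := IwasawaAlgebra.isDomain_quotient_X_pow_add_C p hm
  letI := IwasawaAlgebra.isDiscreteValuationRing_quotient_X_pow_add_C p hm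
  haveI := IwasawaAlgebra.EisensteinCoeff.isLocalRing_succ p hm
  letI := IwasawaAlgebra.EisensteinCoeff.algebraOfSpecSucc p m
  haveI := W.isScalarTower_algebraOfSpecSucc (K := K) (p := p) (m := m)
  letI := W.residueModuleSucc (K := K) (p := p) hm
  exact W.eisensteinDVRSettingLevelsTame_satisfiesH_of κ hm π S hpS hbad L hL hLS jbar
    (ConjugationDatum.ofLifts σ hσ₁ hσ τ hτl hτ₂) D hp2 hK hirr hschur hc₀ hτ
    (W.eisensteinTower_h2Tower κ hm (ConjugationDatum.ofLifts σ hσ₁ hσ τ hτl hτ₂) κ₀ hker hK hanti hc₀ hτ hz ha)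
    (fun k ↦ W.eisensteinDVRSetting_h3_of_isImaginaryQuadratic κ hm hK S hpS hbad L hL hLS k)
    (fun k ↦ W.eisensteinDVRSetting_h4_of_ofLifts κ hm S hpS hbad L hL hLS hPT σ hσ₁ hσ τ hτl hτ₂ D hSσ hfin4 k)
    he_red
    (fun k ↦ W.eisensteinDVRSetting_h5b_of κ hm S hpS hbad L hL hLS jbar σ hσ₁ hσ τ hτl hτ₂ D
      (W.eisensteinLevelsTameFs κ hm π S hpS hbad L hL hLS) hSσ hfin5b k)
    h5c

end WeierstrassCurve

end
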